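import Summits.SmoothPoincare4.SmoothPoincare4.Theorems.ConvexBisectionAcyclicBisectionExistsHurwitzReduction
import Literature.Topology.FourManifolds.AmbientIsotopyRestrict
import Literature.Topology.FourManifolds.AmbientIsotopyTransport
import HarnessLib

/-!
# N1 ▸ `node_N1_move` ▸ (c₁) THE FREE SLICE MOVE: the SEAM FLOW — the rigid page rotation conjugated to the
# boundary `∂X₀` by the page-certifying diffeomorphism `Ψ`
(wave 8, brick of stub `stub_M2geo` = node N1 of NF4 ▸ `node_N1_move_of_pieces (HC1) …` ▸ `HC1` ▸ hypotheses
`HCORE` (route step (iii)) and `HISO` of `piece_c1_of_pieces` (`…SliceMoveAssembly.lean`); line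
`modp-braid-orbits`, crux `ConvexBisection.AcyclicBisectionExists`, item stmt-SmoothPoincare4-10508; worker J5,
lead c5; design v3 `work/design/N1_SliceMove_Design.lean` (J5-5); registered sub-goal `helper_exists_seamFlow`)

In the N1 contract a seam loop is transported by `Ψ (y' θ) = R_T (Ψ (y θ))` for the rigid page rotation
`R` of `Base g` (`rho ∘ R_t = rho`, `w ∘ R_t = e^{it} w`).  This file makes the transport a FLOW: the
ambient isotopy `σ` of the closed `3`-manifold `bX.carrier = ∂X₀` with
**`incl (Ψ (σ_t z)) = R_t (incl (Ψ z))`** — `R` restricted to the boundary `{rho = 1/4} = range (bBase g).incl`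
(`AmbientIsotopy.restrictOfPreserves`, it preserves `rho`) and transferred along `Ψ⁻¹`
(`AmbientIsotopy.transfer`).  Consequences: `σ` raises the boundary page angle `θ_X = arg w ∘ incl ∘ Ψ` by
exactly `t` (`w (incl (Ψ (σ_t z))) = e^{it} w (incl (Ψ z))`), inherits the flow law, and is smooth on ALL of
`∂X₀` — in particular across the belt circles, which is the transverse structure the re-digging core needs
at the old belt (design v3, J5-5) and the generator of the isotopy of the iso piece (J5-F2).
Everything is proved; no definitions, no named facts, no `sorry`.  Reference: M. W. Hirsch, *Differential
Topology* (1976), Ch. 8 §1 [HirschDT1976].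
-/

noncomputable section

set_option linter.dupNamespace false

open scoped Manifold ContDiff Topology Real
open Set Function

namespace Summit.SmoothPoincare4.SmoothPoincare4.Theorems.AcyclicBisectionExists.ModpBraidOrbits

open Literature.Topology.FourManifolds Literature.Topology.FourManifolds.LefschetzBase

/-! ## §1 The boundary of the base is the level `rho = 1/4` -/

/-- `range (bBase g).incl = {x | rho x = 1/4}` as a preimage. [folklore] -/
theorem range_incl_bBase_eq_preimage (g : ℕ) :
    range (bBase g).incl = (fun x : Base g => rho g x.1) ⁻¹' {(1 / 4 : ℝ)} := by
  ext x
  rw [(bBase g).range_incl, RegularSublevel.mem_boundary_iff, mem_preimage, mem_singleton_iff]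
  exact Iff.rfl

/-! ## §2 The seam flow -/

/-- **Sub-goal `helper_exists_seamFlow`** (fully qualified): for a boundary datum `bX` of `X₀`, a
diffeomorphism `Ψ : ∂X₀ ≅ ∂ Base g` and an ambient isotopy `R` of `Base g` preserving `rho`, there is an
ambient isotopy `σ` of `∂X₀` with `incl (Ψ (σ_t z)) = R_t (incl (Ψ z))` for all `t`, `z`.
[cite: HirschDT1976, Ch. 8 §1] -/
theorem helper_exists_seamFlow : ∀ (g : ℕ) (X₀ : Type) [TopologicalSpace X₀] [ChartedSpace (EuclideanHalfSpace 4) X₀] (bX : Literature.Topology.FourManifolds.BoundaryData (𝓡∂ 4) X₀ (𝓡 3)) (Ψ : bX.carrier ≃ₘ⟮𝓡 3, 𝓡 3⟯ (Literature.Topology.FourManifolds.LefschetzBase.bBase g).carrier) (R : Literature.Topology.FourManifolds.AmbientIsotopy (𝓡∂ 4) (Literature.Topology.FourManifolds.LefschetzBase.Base g)), (∀ (t : ℝ) (x : Literature.Topology.FourManifolds.LefschetzBase.Base g), Literature.Topology.FourManifolds.LefschetzBase.rho g (R.toFun t x).1 = Literature.Topology.FourManifolds.LefschetzBase.rho g x.1)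 → ∃ σ : Literature.Topology.FourManifolds.AmbientIsotopy (𝓡 3) bX.carrier, ∀ (t : ℝ) (z : bX.carrier), (Literature.Topology.FourManifolds.LefschetzBase.bBase g).incl (Ψ (σ.toFun t z)) = R.toFun t ((Literature.Topology.FourManifolds.LefschetzBase.bBase g).incl (Ψ z)) := by
  intro g X₀ _ _ bX Ψ R hRρ
  have hf : ∀ (t : ℝ) (x : Base g), (fun x : Base g => rho g x.1) (R.toFun t x) =
      (fun x : Base g => rho g x.1) x := fun t x => hRρ t x
  set σB : AmbientIsotopy (𝓡 3) (bBase g).carrier :=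
    R.restrictOfPreserves (bBase g).isSmoothEmbedding (range_incl_bBase_eq_preimage g) hf
  refine ⟨σB.transfer Ψ.symm, fun t z => ?_⟩
  rw [AmbientIsotopy.transfer_toFun, Diffeomorph.apply_symm_apply]
  change (bBase g).incl (σB.toFun t (Ψ z)) = _
  exact R.apply_restrictOfPreserves (bBase g).isSmoothEmbedding (range_incl_bBase_eq_preimage g) hf t (Ψ z)

/-! ## §3 Consequences: angle, flow law, inverse stages -/

section Consequences

variable {g : ℕ} {X₀ : Type} [TopologicalSpace X₀] [ChartedSpace (EuclideanHalfSpace 4) X₀]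
  {bX : BoundaryData (𝓡∂ 4) X₀ (𝓡 3)} {Ψ : bX.carrier ≃ₘ⟮𝓡 3, 𝓡 3⟯ (bBase g).carrier}
  {R : AmbientIsotopy (𝓡∂ 4) (Base g)} {σ : AmbientIsotopy (𝓡 3) bX.carrier}
  (hσ : ∀ (t : ℝ) (z : bX.carrier), (bBase g).incl (Ψ (σ.toFun t z)) = R.toFun t ((bBase g).incl (Ψ z)))

include hσ

/-- **The seam flow raises the boundary page angle by exactly `t`**: if `w ∘ R_t = e^{it} w` then
`w (incl (Ψ (σ_t z))) = e^{it} w (incl (Ψ z))`. [folklore] -/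
theorem w_seamFlow
    (hRw : ∀ (t : ℝ) (x : Base g), w g (R.toFun t x).1 = Complex.exp ((t : ℂ) * Complex.I) * w g x.1)
    (t : ℝ) (z : bX.carrier) :
    w g ((bBase g).incl (Ψ (σ.toFun t z))).1 = Complex.exp ((t : ℂ) * Complex.I) * w g ((bBase g).incl (Ψ z)).1 := by
  rw [hσ, hRw]

/-- **The seam flow inherits the flow law** `σ_t ∘ σ_{t'} = σ_{t+t'}`. [folklore] -/
theorem seamFlow_add (hRflow : ∀ (t t' : ℝ) (x : Base g), R.toFun t (R.toFun t' x) = R.toFun (t + t') x)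
    (t t' : ℝ) (z : bX.carrier) : σ.toFun t (σ.toFun t' z) = σ.toFun (t + t') z := by
  have h1 : (bBase g).incl (Ψ (σ.toFun t (σ.toFun t' z))) = (bBase g).incl (Ψ (σ.toFun (t + t') z)) := by
    rw [hσ t, hσ t', hRflow, hσ (t + t')]
  exact Ψ.injective ((bBase g).injective_incl h1)

/-- With the flow law, `σ_{−t}` inverts `σ_t`. [folklore] -/
theorem seamFlow_neg_apply
    (hRflow : ∀ (t t' : ℝ) (x : Base g), R.toFun t (R.toFun t' x) = R.toFun (t + t') x)
    (t : ℝ) (z : bX.carrier) : σ.toFun (-t) (σ.toFun t z) = z := by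
  rw [seamFlow_add hσ hRflow, neg_add_cancel, σ.map_zero]
  rfl

/-- The norm of `w` is kept by the seam flow when `R` keeps it (rigid rotations do:
`‖e^{it} w‖ = ‖w‖`). [folklore] -/
theorem norm_w_seamFlow
    (hRw : ∀ (t : ℝ) (x : Base g), w g (R.toFun t x).1 = Complex.exp ((t : ℂ) * Complex.I) * w g x.1)
    (t : ℝ) (z : bX.carrier) :
    ‖w g ((bBase g).incl (Ψ (σ.toFun t z))).1‖ = ‖w g ((bBase g).incl (Ψ z)).1‖ := by
  rw [w_seamFlow hσ hRw, norm_mul, Complex.norm_exp_ofReal_mul_I, one_mul]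

end Consequences

end Summit.SmoothPoincare4.SmoothPoincare4.Theorems.AcyclicBisectionExists.ModpBraidOrbits

end
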